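import Literature.Computability.MetaComplexity.HeuristicClasses
import Literature.Computability.Complexity.RandomizedProofs
import HarnessLib

/-!
# Deterministic schemes are randomized schemes: `HeurP ⊆ HeurBPP`, `AvgP ⊆ AvgBPP` (proofs)

Second sibling proof file of `HeuristicClasses.lean` (D-0014: named facts `def X : Prop` are
discharged as `theorem X_holds : X`; the first sibling, `HeuristicClassesProofs.lean`, discharges
`distClass_BPP_subset_HeurBPP`). This file discharges the two inclusions of
`HeuristicClasses.lean` that need no amplification:

* `Literature.CplxMeta.HeurP_subset_HeurBPP_holds : HeurP_subset_HeurBPP` — a deterministic heuristic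
  scheme is a randomized heuristic scheme;
* `Literature.CplxMeta.AvgP_subset_AvgBPP_holds : AvgP_subset_AvgBPP` — a deterministic errorless
  heuristic scheme is a randomized errorless heuristic scheme.

(The third inclusion `AvgBPP_subset_HeurBPP` needs amplification of the inner constant `1/4` by
majority vote and is not treated here.)

## The printed definitions and the proof here

Bogdanov–Trevisan (2006), §2.2 define errorless heuristic schemes `A(x; n, δ) ∈ {L(x), ⊥}` on
`supp Dₙ` with `Pr_{x ∼ Dₙ}[A = ⊥] ≤ δ` (Def. 2.4; arXiv:cs/0606037v3 Def. 6) and heuristic schemes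
with `Pr_{x ∼ Dₙ}[A ≠ L(x)] ≤ δ` (Def. 2.9; arXiv Def. 10–11), and §2.3 their randomized versions:
a randomized errorless heuristic has `Pr_coins[A(x; n) ∉ {L(x), ⊥}] ≤ 1/4` for every
`x ∈ supp Dₙ` and `Pr_{x ∼ Dₙ}[Pr_coins[A(x; n) = ⊥] ≥ 1/4] ≤ δ(n)` (Def. 2.11; arXiv Def. 12),
a randomized heuristic has `Pr_{x ∼ Dₙ}[Pr_coins[A(x; n) ≠ L(x)] ≥ 1/4] ≤ δ(n)` (Def. 2.12–2.13;
arXiv Defs. 14–15). The containment of the deterministic classes in the randomized ones is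
implicit there (a deterministic algorithm is a randomized one that ignores its coins; §2.3 opens
with "We will also be interested in non-uniform and randomized heuristic algorithms").

In the vendored form: a deterministic scheme `A(x, 1ⁿ, 1ᵐ)` (polynomial time from `schemeEnc`)
is the coin-free randomized algorithm `RandAlg.ofDet A` on scheme inputs, which is PPT by
`RandAlg.IsPolyTime.ofDet_holds` (`Complexity/RandomizedProofs.lean`: compose with the pair
projection, coin budget `0`), and whose output distribution is the point mass at `A(x, 1ⁿ, 1ᵐ)`
(`RandAlg.pr_ofDet`: probabilities of events are `0` or `1`). Hence the set of bad inputs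
`{x | Pr_coins[A ≠ L(x)] ≥ 1/4}` *equals* the error set `{x | A ≠ L(x)}` (resp.
`{x | Pr_coins[A = ⊥] ≥ 1/4} = {x | A = ⊥}`), whose `Dₙ`-probability is `≤ 1/m` by hypothesis,
and for `x ∈ supp Dₙ` errorlessness (`IsErrorlessFor`) gives `A(x) ≠ some (¬L(x))`, i.e.
`Pr_coins[A(x) = ¬L(x)] = 0 ≤ 1/4`.

## References

* A. Bogdanov, L. Trevisan, *Average-Case Complexity*, Found. Trends TCS 2 (2006), §2.2
  (Def. 2.4, Def. 2.9) and §2.3 (Def. 2.11 randomized errorless heuristics, Def. 2.12–2.13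
  randomized heuristic schemes); arXiv:cs/0606037v3, Defs. 6, 10–15, pp. 15–19.
* S. Arora, B. Barak, *Computational Complexity: A Modern Approach*, CUP 2009, §7.1 (a
  deterministic machine is a probabilistic one; `P ⊆ BPP`).
-/

namespace Literature.Computability.MetaComplexity

open _root_.Computability Complexity

/-- **Discharge of `HeurP_subset_HeurBPP`** (a deterministic heuristic scheme is a randomized
one, `HeurP ⊆ HeurBPP`). View the `HeurP` witness `A(x, 1ⁿ, 1ᵐ) ∈ {0,1}` as the coin-free
randomized algorithm `RandAlg.ofDet A` on scheme inputs: it is PPT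
(`RandAlg.IsPolyTime.ofDet_holds`), and its coin error on `x` is the indicator of `A(x) ≠ L(x)`
(`RandAlg.pr_ofDet`), so the bad set `{x | Pr_coins[A ≠ L(x)] ≥ 1/4}` **equals** the error set
`{x | A(x, 1ⁿ, 1ᵐ) ≠ L(x)}`, of `Dₙ`-probability `≤ 1/m`. Implicit in print (Def. 2.12–2.13
specialise to Def. 2.9 for an algorithm ignoring its coins).
[Bogdanov–Trevisan 2006, §2.3, Def. 2.12–2.13 (arXiv:cs/0606037v3, Defs. 14–15, p. 19)]
[cite: BogdanovTrevisan2006, §2.3 (Def. 2.12–2.13)] -/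
theorem HeurP_subset_HeurBPP_holds : HeurP_subset_HeurBPP := by
  classical
  rintro Q ⟨A, hA, hfail⟩
  refine ⟨RandAlg.ofDet fun q : List Bool × ℕ × ℕ => A q.1 q.2.1 q.2.2,
    RandAlg.IsPolyTime.ofDet_holds hA, fun n m hm => ?_⟩
  have hset :
      {x | (1 : ℝ) / 4 ≤ (RandAlg.ofDet fun q : List Bool × ℕ × ℕ => A q.1 q.2.1 q.2.2).pr
        schemeEnc (x, n, m) {b | b ≠ Q.lang.boolIndicator x}} =
      {x | A x n m ≠ Q.lang.boolIndicator x} := by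
    ext x
    simp only [Set.mem_setOf_eq, RandAlg.pr_ofDet]
    split_ifs with h
    · exact iff_of_true (by norm_num) h
    · exact iff_of_false (by norm_num) h
  rw [hset]
  exact hfail n m hm

/-- **Discharge of `AvgP_subset_AvgBPP`** (a deterministic errorless heuristic scheme is a
randomized one, `AvgP ⊆ AvgBPP`). View the `AvgP` witness `A(x, 1ⁿ, 1ᵐ) ∈ {0,1,⊥}` as the
coin-free `RandAlg.ofDet A`: it is PPT (`RandAlg.IsPolyTime.ofDet_holds`); for `x ∈ supp Dₙ`
errorlessness gives `A(x) ≠ ¬L(x)`, so `Pr_coins[A(x) = ¬L(x)] = 0 ≤ 1/4` (`RandAlg.pr_ofDet`);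
and the bad set `{x | Pr_coins[A = ⊥] ≥ 1/4}` equals the failure set `{x | A(x, 1ⁿ, 1ᵐ) = ⊥}`,
of `Dₙ`-probability `≤ 1/m`. Implicit in print (Def. 2.11 specialises to Def. 2.4 for an
algorithm ignoring its coins); it is the first half of the tree's interim route
`AvgP ⊆ AvgBPP ⊆ HeurBPP`. [Bogdanov–Trevisan 2006, §2.3, Def. 2.11 (arXiv:cs/0606037v3,
Defs. 12–13, pp. 18–19)] [cite: BogdanovTrevisan2006, §2.3 (Def. 2.11)] -/
theorem AvgP_subset_AvgBPP_holds : AvgP_subset_AvgBPP := by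
  classical
  rintro Q ⟨A, hA, herr, hfail⟩
  refine ⟨RandAlg.ofDet fun q : List Bool × ℕ × ℕ => A q.1 q.2.1 q.2.2,
    RandAlg.IsPolyTime.ofDet_holds hA, fun n m x hx => ?_, fun n m hm => ?_⟩
  · rw [RandAlg.pr_ofDet]
    split_ifs with h
    · exact absurd (herr m n x hx _ h) (by cases Q.lang.boolIndicator x <;> decide)
    · norm_num
  · have hset :
        {x | (1 : ℝ) / 4 ≤ (RandAlg.ofDet fun q : List Bool × ℕ × ℕ => A q.1 q.2.1 q.2.2).pr
          schemeEnc (x, n, m) {none}} = {x | A x n m = none} := by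
      ext x
      simp only [Set.mem_setOf_eq, RandAlg.pr_ofDet, Set.mem_singleton_iff]
      split_ifs with h
      · exact iff_of_true (by norm_num) h
      · exact iff_of_false (by norm_num) h
    rw [hset]
    exact hfail n m hm

end Literature.Computability.MetaComplexity
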